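import Literature.MathematicalPhysics.QuantumFieldTheory.Balaban1983to89.B9Thm39CinvAtCoverLarge

/-!
# `Balaban1983to89.B9Thm39CinvAtCoverMember` — [Balaban1985BackgroundPropagators] THEOREM 3.9 pp. 411–413 ⇒ THEOREM 3.2 (3.48) p. 398 FOR
# `C(U) = (Q′G′²Q′*)⁻¹(U)` AT GENERIC LETTERS `(parS, G′, U)` OF def-Y, AT THE CUBE COVER OF RECORD, «FOR M SUFFICIENTLY LARGE» IN FULL, FROM SITE MAJORANTS OF
# `η⁴G′²`, `η⁴G′_□²`: FILES 10 ∕ 12 ∕ 13 re-run one level lower, on FILE 9b's member-level `hasMajorant_conj_XinvY_final_loc` instead of its `EBlock` corollary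
# (cell `lit-balaban`, G-B9-LETTERS module M5.6 FILE 14, seat p21 gen 33)

statement-level skeleton of published theorems with citation tags; proofs where landed; nothing here is a claim about the Yang–Mills mass gap

CITATION HEADER (lean-in-tree rule).  B9 = T. Bałaban, *Propagators for lattice gauge theories in a background field*, Commun. Math. Phys. **99** (1985)
389–434: p. 408 «We take a family 𝒟_j of cubes □ … which are unions of 2ᵈ big blocks», «□̃ⁿ … with the same center as □»; p. 409 (3.87) «C₀ = Σ_{□∈𝒟} h_□C_□h_□»;
p. 411 (3.95), «By the same estimates as in [4], especially (2.83)–(2.85), we can see that the operator R is small», «separated at least by a distance MLʲη»,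
«estimated by e^{−¼δ₀M}»; p. 412 (3.97) «estimated by (2δ₀M)⁻¹», «already localized and give small factors O(M⁻¹)»; p. 413 Theorem 3.9 «For M sufficiently large …
This theorem implies Theorem 3.2»; p. 398 Theorem 3.2 (3.48) «|(Q′(U)G′²(U)Q′*(U))⁻¹(y, y′)| ≦ B₀(Lʲη)⁻⁴(L^{j′}η)^{−d}e^{−δ₀d(y,y′)}, y, y′ ∈ 𝔅», p. 398 «Using Lemma
2.1 in [4] we may replace the factor (Lʲη)^α by (Lʲη)^β(L^{j′}η)^γ».  [4] = [Balaban1984PropagatorsII] (2.36) p. 229 «Σ h²_□ = 1», Lemma 2.1 (2.59)–(2.61), (2.63),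
(2.66) pp. 233–234, (2.83)–(2.87) pp. 237–238 («‖R‖ ≦ ½ and (Q′G′²Q′*)⁻¹ = C(I − R)⁻¹»).  Rows B9.Thm3.9 × B9.Thm3.2 × B4.Eq2.85 (cells only; no row head changes).

WHY THIS FILE.  FILES 10 ∕ 12 ∕ 13 (`B9Thm39CinvAtCover`, `…Above`, `…Large`) discharge the cube cover of record, the geometry above one M-threshold and the located
smallness of the (3.48)-assembly — but on the `EBlock` road (inputs: M5.5's `EBlock`s of `G′`, `G′_□` over the invariant class, turned into site majorants of `η⁴G′²`
by FILE 7).  The junction at print's transporters (cell row J-B, `B9B8KnitLetterCinvFromM56`) consumes M5.6 one level LOWER: at generic letters `(parS, G′, U)` with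
SITE majorants of `η⁴G′²`, `η⁴G′_□²` of the shape `κ_G·ℓ(a)⁴·e^{−a_Lδ₀d}` ([4] (2.83) «O(1)(Lʲη)⁴e^{−½δ₀d(y,y″)}», produced there from (3.42)₁-shape majorants of `η²G′`).
THIS FILE re-runs the three discharges at that level, on FILE 9b's `hasMajorant_conj_XinvY_final_loc` (printed-shape per-cube inputs: un-localized (3.48) blocks
`hC` of the `C_□`, LOCALIZED [2]-difference `hD`): §1 the cover of record, §2 the geometry above one threshold, §3 the smallness — ending in (3.48) for
`(Q′G′²Q′*)⁻¹(U)` with a MEMBER-INDEPENDENT constant for every member above ONE threshold and every letter datum.  FILE 13's `cinv_cover_large` is §3 ∘ FILE 7.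

WHAT IS PROVED (all `theorem`s, 0 `def`, 0 sorry, 0 new named facts).
* §1 ★★ `final_cover` — FILE 9b's `hasMajorant_conj_XinvY_final_loc` AT THE CUBE COVER OF RECORD: `h_□ := hB i.D □` (p. 408 ∕ [4] (2.36), read on 𝔅), `χ_□ := 1_{□̃}`
  (`chiBigT`), `S_□ := □⁺` (`SQT`), `S^χ_□ := □̃` (`SQbigT`), `N := 3·5^{d+1}`, `D_sep := M∕(2L²)` (`DsepT`), `ℓ₀ := 0`, `ℓ₁ := 2s_T∕M` (`lipT`), `s := (η²η²)⁻¹`,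
  `s′ := η²η²`, weight `P := ℓ⁻⁴`, the four distance facts of `geo9K` — all by FILE 10's cover lemmas BY NAME; displayed: `IsUnit XY`, contractive transporters, the
  coordinate bound, the site majorants `hGG`∕`hGGc`, per-cube `hloc`∕`hC`∕localized `hD`, the scale transfer of `ℓ⁻⁴`, (2.61) at `(δ₀, b−ρ)`, (2.61)∕(2.63) at
  `(ρδ₀, α′)`, the exponent splits, the located smallness.
* §2 ★★ `final_cover_above` — §1 FOR EVERY MEMBER ABOVE ONE THRESHOLD with the geometry discharged (FILE 11: [4] Lemma 2.1 at `(δ₀, b−ρ)` and `(ρδ₀, α′)` under one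
  ∃-threshold at a common exponent `d′`, (2.63), the p. 398 scale transfer of `ℓ⁻⁴` with constant `L⁴` from the explicit size condition folded into the threshold).
* §3 ★★★ `final_cover_large` — §2 with the located smallness discharged (FILE 13's `smallness_shape` BY NAME: `θ₁ = A₁e^{−a_sepδ₀M∕(2L²)}`, `θ₂ = A₂e^{−δ₀M∕L²}`,
  `θ₃ = A₃∕M`, each `≦ 1∕(6c₁)` above constants-only thresholds, so `(1 − Σθc₁)⁻¹ ≦ 2` — print's «‖R‖ ≦ ½»): THERE ARE `M_L` and `K ≧ 0`
  (`K = 2·3·5^{d+1}·B₀·c₁(d′, ρδ₀, α′)`) such that for EVERY member `i` with `M_L ≦ M_i` and EVERY letter datum `(parS, G′, U)`, section `ιB`, cube letters `G′_□`, `C_□`: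
  from `IsUnit (Q′G′²Q′*)(U)`, contractive transporters, the site majorants `conj b ((η²η²)•(G′·G′)) ≺ κ_G·ℓ(a)⁴·e^{−a_Lδ₀d}` (and for each `G′_□`), the per-cube local
  inverse property, un-localized (3.48) blocks of the `C_□` (constant `B₀`, rate `bδ₀`) and localized [2]-difference majorants (constant `κ_De^{−2δ₀D_sep}`, rate `a_Dδ₀`):
  `conj b ((η²η²)⁻¹•(Q′G′²Q′*)⁻¹(U)) ≺ K·ℓ(a)⁻⁴·e^{−(1−α′)ρδ₀d(a,a′)}` on the block carrier `(t, j) ↦ ιB t`.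

HONEST SCOPE / NOT CLAIMED.  Composition (plumbing) of landed theorems, M5.6's scope: the analytic inputs of Theorem 3.9's mechanism stay DISPLAYED per member and
letter — the site majorants of `η⁴G′²`, `η⁴G′_□²` (Theorem 3.1-type data: M5.5 ∕ FILE 7 on the `EBlock` road, the junction's (3.42)₁-shape majorants at print's
transporters), the cube letters (Cor. 3.6 for `C_□`, M5.2-E; at print's transporters they must be supplied AT those transporters), the localized [2]-difference
estimate (GAP G-B9-05 — NOT derived in the tree), `IsUnit XY` (w1 ∕ the junction's `isUnit_XY_…` at the letters of record), transporter and coordinate bounds.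
«M sufficiently large» is the existential threshold `M_L` (door construction + explicit size conditions; no numerical `M`).  Sup-entry (3.48) only; finite 𝕋
members of the k-level V1 family; nothing continuum, nothing about OS axioms or the mass gap; NOT summit progress.  RELATED, NOT DUPLICATED: FILES 9b ∕ 10 ∕ 11 ∕
12 ∕ 13 (USED BY NAME; FILE 13 = §3 at FILE 7's site majorants).  Searched 2026-08-28: `lean search 'CinvAtCoverMember|final_cover' --decl` = ∅.
-/

noncomputable section

namespace Literature.MathematicalPhysics.QuantumFieldTheory.Balaban1983to89.B9Thm39CinvAtCoverMember

open Node00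
open B6Geom246MultiLevelBox (blkOf)
open B6Cover236MultiLevelBlocks (cubes)
open B6Cover236MultiLevelTorusBlocks (hB cubeIndT)
open B6Partition118KLevelTorusBinders (sLipT)
open B6Ineq2142KLevelV1 (β)
open B6KLevelCensusIndexV1 (KIdx)
open B6RandomWalk (HasMajorant Ineq261 Ineq263 hasMajorant_mono)
open B9Thm34Ext (toB6)
open B9GeoNormsKLevelV1 (geo9K)
open B9GeoLemma21KLevelV1 (one_le_Mh)
open B9RWSums347DefiniteFaces (exp261)
open B9Eq352DivFormLetters (conj)
open B9Thm37CubeCoverCommutators (cutMulY)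
open B9Thm37CubeCoverCommutatorSizes (four_le_P')
open B9Thm37GpTorusRegularCubes (SQT hcnt_SQT)
open B9Ineq349SiteComposite (etaS_pos)
open B9Thm39CinvFinalLoc (hasMajorant_conj_XinvY_final_loc)
open B9Thm39CinvAtCover (SQbigT chiBigT DsepT lipT indicator_SQbigT_eq indicator_SQT_eq sum_hB_sq_blk abs_hB_le hS_cover hsep_cover hLip_cover
  geo9K_basic lipT_nonneg chiBigT_01 chiBigT_eq_one chiBigT_supp)
open B9GeoInputsMultiRateKLevelV1 (geo_inputs3_geo9K scaleTransfer_len_inv4_geo9K)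
open B9Thm39CinvAtCoverAbove (size_of_threshold)
open B9Thm39CinvAtCoverLarge (smallness_shape DsepT_eq_div lipT_eq)

variable {d ℓ : ℕ} {hd : 1 ≤ d + 1} {hL : Odd (ℓ + 1) ∧ 1 < ℓ + 1} {b₀ b₁ : ℝ}
variable {𝔸 : Type} [NormedRing 𝔸] [NormedAlgebra ℂ 𝔸] [CompleteSpace 𝔸]
variable {ι : Type} [Fintype ι] [DecidableEq ι]

/-! ## §1 ★★ FILE 9b's member-level assembly at the cube cover of record -/

section Cover

variable (i : KIdx d ℓ hd hL b₀ b₁) (b : Module.Basis ι ℝ 𝔸)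
variable [Fintype (geo9K i).Site] [DecidableEq (geo9K i).Site] {Rr : ℝ} {Hp : Prop}
variable (parS : SiteParY 𝔸 i) (Gp : SiteOpY 𝔸 i) (U : CfgY 𝔸 i) (ιB : BlkY i → IBondY i)

/-- ★★ **THEOREM 3.9 ⇒ THEOREM 3.2 (3.48) FOR `C(U) = (Q′G′²Q′*)⁻¹(U)` AT GENERIC LETTERS, AT THE CUBE COVER OF RECORD** (FILE 9b `hasMajorant_conj_XinvY_final_loc` with
`h_□ := hB i.D □` — «Σ h²_□ = 1», read on 𝔅 —, `χ_□ := 1_{□̃}`, `S_□ := □⁺`, `S^χ_□ := □̃`, `N := 3·5^{d+1}`, `D_sep := M/(2L²)`, `ℓ₀ := 0`, `ℓ₁ := 2s_T/M`, `s := (η²η²)⁻¹`,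
`s′ := η²η²`, `P := ℓ⁻⁴` and the four distance facts of `geo9K` discharged): from `IsUnit (XY i parS G′ U)`, contractive transporters, the coordinate bound `M₂` of `b`,
the SITE majorants `conj b ((η²η²)•(G′·G′)) ≺ κ_G·ℓ(a)⁴·e^{−a_Lδ₀d}` of `G′ = Gp` and of every cube letter `G′_□ = Oc □`, the per-cube local inverse property `hloc` and
un-localized (3.48) blocks `hC` of the `C_□ = Cl □`, the LOCALIZED [2]-difference majorants `hD` of `conj b ((η²η²)•(M_{1_{□̃}}(XY G′ − XY G′_□)M_{1_{□⁺}}))` (GAP G-B9-05),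
the scale transfer of `ℓ⁻⁴` at `α_st`, (2.61) at `(δ₀, b−ρ)`, (2.61)/(2.63) at `(ρδ₀, α′)`, the exponent splits and the located smallness ⟹
`conj b ((η²η²)⁻¹•(XinvY i parS G′ U)) ≺ 3·5^{d+1}·B₀·c₁(ρδ₀,α′)(1 − (θ₁+θ₂+θ₃)c₁(ρδ₀,α′))⁻¹·ℓ(a)⁻⁴·e^{−(1−α′)ρδ₀d(a,a′)}` on the block carrier `(t, j) ↦ ιB t`.
[cite: Balaban1985BackgroundPropagators, Thm 3.9 p.413 + (3.95)–(3.97) pp.411–412 + (3.87) p.409 + p.408 + Thm 3.2 (3.48) p.398;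
Balaban1984PropagatorsII, (2.36) p.229 + Lemma 2.1 p.234 + (2.83)–(2.85) pp.237–238] -/
theorem final_cover (Oc : ↥(cubes i.D.toDomains) → SiteOpY 𝔸 i) (hι : ∀ s, β i.hN i.D i.hk (ιB s) = s)
    (hunit : IsUnit (XY i parS Gp U))
    (hpar : ∀ z w : SiteY i, ‖(parS U z w : 𝔸)‖ ≤ 1 ∧ ‖(((parS U z w)⁻¹ : 𝔸ˣ) : 𝔸)‖ ≤ 1)
    {M₂ : ℝ} (hM₂ : 0 ≤ M₂) (hrepr : ∀ (v : 𝔸) (j : ι), |b.repr v j| ≤ M₂ * ‖v‖) (d' : ℕ)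
    {δ₀ aL aD αc αst asep ρ bb κG κD B₀ C α' θ₁ θ₂ θ₃ : ℝ}
    (Cl : ↥(cubes i.D.toDomains) → Module.End ℝ (BlkY i → 𝔸))
    (hκG : 0 ≤ κG) (hκD : 0 ≤ κD) (hB₀ : 0 ≤ B₀) (hC0 : 0 ≤ C)
    (hδ₀ : 0 ≤ δ₀) (hasep : 0 ≤ asep) (hρ : 0 ≤ ρ) (hρb : ρ ≤ bb) (hαc : 0 < αc * δ₀) (hα'1 : α' ≤ 1)
    (hsplit₁ : αst + asep + ρ ≤ aL) (hsplit₂ : αst + ρ ≤ aD) (hsplit₃ : αst + αc + ρ ≤ aL)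
    (hθ₁ : θ₁ = (3 * 5 ^ (d + 1)) * (((M₂ * ∑ j, ‖b j‖) ^ 2 * κG) * B₀ * C * B6.c1 d' δ₀ (bb - ρ) * Real.exp (-(asep * δ₀ * DsepT i))))
    (hθ₂ : θ₂ = (3 * 5 ^ (d + 1)) * (κD * Real.exp (-(2 * δ₀ * DsepT i)) * B₀ * C * B6.c1 d' δ₀ (bb - ρ)))
    (hθ₃ : θ₃ = (3 * 5 ^ (d + 1)) * ((lipT i * (αc * δ₀)⁻¹) * ((M₂ * ∑ j, ‖b j‖) ^ 2 * κG) * B₀ * C * B6.c1 d' δ₀ (bb - ρ)))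
    (hST : B9Ineq347.ScaleTransfer (geo9K i) δ₀ αst C (fun a => ((geo9K i).len a ^ 4)⁻¹)) (h261b : Ineq261 d' (toB6 (geo9K i) Rr Hp) δ₀ (bb - ρ))
    (h261 : Ineq261 d' (toB6 (geo9K i) Rr Hp) (ρ * δ₀) α') (h263 : Ineq263 d' (toB6 (geo9K i) Rr Hp) (ρ * δ₀) α')
    (hsmall : (θ₁ + θ₂ + θ₃) * B6.c1 d' (ρ * δ₀) α' < 1)
    (hloc : ∀ c, (cutMulY (𝔸 := 𝔸) (hB i.D c)).restrictScalars ℝ *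
      ((cutMulY (𝔸 := 𝔸) (chiBigT i c)).restrictScalars ℝ * (XY i parS (Oc c) U).restrictScalars ℝ) * Cl c *
        (cutMulY (𝔸 := 𝔸) (hB i.D c)).restrictScalars ℝ =
      (cutMulY (𝔸 := 𝔸) (hB i.D c)).restrictScalars ℝ * (cutMulY (𝔸 := 𝔸) (hB i.D c)).restrictScalars ℝ)
    (hC : ∀ c, HasMajorant (g := toB6 (geo9K i) Rr Hp) (fun p : BlkY i × ι => ιB p.1) (conj b ((etaS i ^ 2 * etaS i ^ 2)⁻¹ • Cl c))
      (fun a a' => B₀ * ((geo9K i).len a ^ 4)⁻¹ * Real.exp (-(bb * δ₀ * (geo9K i).dist a a'))))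
    (hGG : HasMajorant (g := toB6 (geo9K i) Rr Hp) (fun p : SiteY i × ι => ιB (blkOf i.D.toDomains p.1))
      (conj b ((etaS i ^ 2 * etaS i ^ 2) • ((Gp U).restrictScalars ℝ * (Gp U).restrictScalars ℝ)))
      (fun a a'' => κG * (geo9K i).len a ^ 4 * Real.exp (-(aL * δ₀ * (geo9K i).dist a a''))))
    (hGGc : ∀ c, HasMajorant (g := toB6 (geo9K i) Rr Hp) (fun p : SiteY i × ι => ιB (blkOf i.D.toDomains p.1))
      (conj b ((etaS i ^ 2 * etaS i ^ 2) • ((Oc c U).restrictScalars ℝ * (Oc c U).restrictScalars ℝ)))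
      (fun a a'' => κG * (geo9K i).len a ^ 4 * Real.exp (-(aL * δ₀ * (geo9K i).dist a a''))))
    (hD : ∀ c, HasMajorant (g := toB6 (geo9K i) Rr Hp) (fun p : BlkY i × ι => ιB p.1)
      (conj b ((etaS i ^ 2 * etaS i ^ 2) • ((cutMulY (𝔸 := 𝔸) (chiBigT i c)).restrictScalars ℝ *
        ((XY i parS Gp U).restrictScalars ℝ - (XY i parS (Oc c) U).restrictScalars ℝ) *
        (cutMulY (𝔸 := 𝔸) (cubeIndT i.D (one_le_Mh i) (four_le_P' i) c)).restrictScalars ℝ)))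
      (fun a a'' => κD * Real.exp (-(2 * δ₀ * DsepT i)) * (geo9K i).len a ^ 4 * Real.exp (-(aD * δ₀ * (geo9K i).dist a a'')))) :
    HasMajorant (g := toB6 (geo9K i) Rr Hp) (fun p : BlkY i × ι => ιB p.1)
      (conj b ((etaS i ^ 2 * etaS i ^ 2)⁻¹ • (XinvY i parS Gp U).restrictScalars ℝ))
      (fun a a' => (3 * 5 ^ (d + 1)) * B₀ * B6.c1 d' (ρ * δ₀) α' * (1 - (θ₁ + θ₂ + θ₃) * B6.c1 d' (ρ * δ₀) α')⁻¹ * ((geo9K i).len a ^ 4)⁻¹ *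
        Real.exp (-((1 - α') * (ρ * δ₀) * (geo9K i).dist a a'))) := by
  obtain ⟨htri, hrefl, hsymm, hdnn⟩ := geo9K_basic i (Rr := Rr) (Hp := Hp)
  have hη : etaS i ^ 2 * etaS i ^ 2 ≠ 0 := ne_of_gt (mul_pos (pow_pos (etaS_pos i) 2) (pow_pos (etaS_pos i) 2))
  have hP : ∀ a : (geo9K i).Site, 0 < ((geo9K i).len a ^ 4)⁻¹ := fun a => inv_pos.mpr (pow_pos (B6KLevelCensusIndexV1.len_pos i a) 4)
  -- the site majorants at the weight `(P a)⁻¹ = ((ℓ⁴)⁻¹)⁻¹`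
  have hGG' : HasMajorant (g := toB6 (geo9K i) Rr Hp) (fun p : SiteY i × ι => ιB (blkOf i.D.toDomains p.1))
      (conj b ((etaS i ^ 2 * etaS i ^ 2) • ((Gp U).restrictScalars ℝ * (Gp U).restrictScalars ℝ)))
      (fun a a'' => κG * (((geo9K i).len a ^ 4)⁻¹)⁻¹ * Real.exp (-(aL * δ₀ * (geo9K i).dist a a''))) :=
    hasMajorant_mono (g := toB6 (geo9K i) Rr Hp) _ hGG fun a a'' => le_of_eq (by rw [inv_inv])
  have hGGc' : ∀ c, HasMajorant (g := toB6 (geo9K i) Rr Hp) (fun p : SiteY i × ι => ιB (blkOf i.D.toDomains p.1))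
      (conj b ((etaS i ^ 2 * etaS i ^ 2) • ((Oc c U).restrictScalars ℝ * (Oc c U).restrictScalars ℝ)))
      (fun a a'' => κG * (((geo9K i).len a ^ 4)⁻¹)⁻¹ * Real.exp (-(aL * δ₀ * (geo9K i).dist a a''))) := fun c =>
    hasMajorant_mono (g := toB6 (geo9K i) Rr Hp) _ (hGGc c) fun a a'' => le_of_eq (by rw [inv_inv])
  -- the localized [2]-difference at FILE 9b's indicator cut-offs `1_{S^χ_□}∘ιB = 1_{□̃}`, `1_{S_□}∘ιB = 1_{□⁺}` and the weight `(P a)⁻¹`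
  have hD' : ∀ c, HasMajorant (g := toB6 (geo9K i) Rr Hp) (fun p : BlkY i × ι => ιB p.1)
      (conj b ((etaS i ^ 2 * etaS i ^ 2) • ((cutMulY (𝔸 := 𝔸) (fun t : BlkY i => if ιB t ∈ SQbigT i c then (1 : ℝ) else 0)).restrictScalars ℝ *
        ((XY i parS Gp U).restrictScalars ℝ - (XY i parS (Oc c) U).restrictScalars ℝ) *
        (cutMulY (𝔸 := 𝔸) (fun t : BlkY i => if ιB t ∈ SQT i c then (1 : ℝ) else 0)).restrictScalars ℝ)))
      (fun a a'' => κD * Real.exp (-(2 * δ₀ * DsepT i)) * (((geo9K i).len a ^ 4)⁻¹)⁻¹ * Real.exp (-(aD * δ₀ * (geo9K i).dist a a''))) := fun c => by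
    rw [indicator_SQbigT_eq i ιB hι c, indicator_SQT_eq i ιB hι c]
    exact hasMajorant_mono (g := toB6 (geo9K i) Rr Hp) _ (hD c) fun a a'' => le_of_eq (by rw [inv_inv])
  exact hasMajorant_conj_XinvY_final_loc i b ιB parS Gp U hunit hpar hM₂ hrepr d' (fun a => ((geo9K i).len a ^ 4)⁻¹)
    (fun c => SQbigT i c) (fun c => SQT i c) (fun c => chiBigT i c) (fun c => hB i.D c) Oc Cl (mul_inv_cancel₀ hη) hκG hκD le_rfl (lipT_nonneg i) hB₀ hC0
    (by positivity) hP hδ₀ hasep hρ hρb hαc hα'1 hsplit₁ hsplit₂ hsplit₃ hθ₁ hθ₂ (by rw [zero_add]; exact hθ₃) htri hrefl hsymm hdnn hST h261b h261 h263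
    hsmall (sum_hB_sq_blk i) (abs_hB_le i) (hS_cover i ιB hι) (hcnt_SQT i) (chiBigT_01 i) (chiBigT_eq_one i ιB hι) (chiBigT_supp i ιB hι)
    (hsep_cover i) (hLip_cover i ιB hι) hloc hC hGG' hGGc' hD'

end Cover

/-! ## §2 ★★ Above one threshold: the geometry discharged (FILE 11) -/

/-- ★★ **§1 FOR EVERY MEMBER ABOVE ONE THRESHOLD, THE GEOMETRY DISCHARGED** («For M sufficiently large»): for rate data `δ₀ > 0`, `0 < ρ < b`, `0 < α′ ≦ 1`, `α_st > 0`
there are a threshold `M_L` and an exponent `d′` such that for every member `i` with `M_L ≦ M_i` §1 holds with [4] Lemma 2.1 at `(δ₀, b−ρ)`, (2.61)/(2.63) at `(ρδ₀, α′)`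
and the scale transfer of `ℓ⁻⁴` (constant `L⁴`) discharged: from `IsUnit XY`, contractive transporters, the coordinate bound, the site majorants `hGG`/`hGGc`, the
per-cube `hloc`/`hC`/localized `hD` at the cover of record, the rate bookkeeping and the located smallness,
`conj b ((η²η²)⁻¹•XinvY i parS G′ U) ≺ 3·5^{d+1}B₀c₁(d′,ρδ₀,α′)(1 − (θ₁+θ₂+θ₃)c₁(d′,ρδ₀,α′))⁻¹·ℓ(a)⁻⁴·e^{−(1−α′)ρδ₀d(a,a′)}`.
[cite: Balaban1985BackgroundPropagators, Thm 3.9 p.413 + Thm 3.2 (3.48) p.398 + p.398 (scale transfer) + (3.95)–(3.97) pp.411–412 + p.408;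
Balaban1984PropagatorsII, Lemma 2.1 (2.59)–(2.61), (2.63) pp.233–234 + (2.83)–(2.85) pp.237–238] -/
theorem final_cover_above [∀ i' : KIdx d ℓ hd hL b₀ b₁, Fintype (geo9K i').Site] [∀ i' : KIdx d ℓ hd hL b₀ b₁, DecidableEq (geo9K i').Site]
    (Rr : KIdx d ℓ hd hL b₀ b₁ → ℝ) (Hp : KIdx d ℓ hd hL b₀ b₁ → Prop) (b : Module.Basis ι ℝ 𝔸)
    {M₂ : ℝ} (hM₂ : 0 ≤ M₂) (hrepr : ∀ (v : 𝔸) (j : ι), |b.repr v j| ≤ M₂ * ‖v‖)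
    {δ₀ αst bb ρ α' : ℝ} (hδ₀ : 0 < δ₀) (hρ : 0 < ρ) (hρb : ρ < bb) (hα'0 : 0 < α') (hα'1 : α' ≤ 1) (hαst : 0 < αst) :
    ∃ (ML : ℝ) (d' : ℕ), ∀ i : KIdx d ℓ hd hL b₀ b₁, ML ≤ (geo9K i).M →
      ∀ (parS : SiteParY 𝔸 i) (Gp : SiteOpY 𝔸 i) (U : CfgY 𝔸 i) (ιB : BlkY i → IBondY i) (Oc : ↥(cubes i.D.toDomains) → SiteOpY 𝔸 i)
        (hι : ∀ s, β i.hN i.D i.hk (ιB s) = s) (hunit : IsUnit (XY i parS Gp U))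
        (hpar : ∀ z w : SiteY i, ‖(parS U z w : 𝔸)‖ ≤ 1 ∧ ‖(((parS U z w)⁻¹ : 𝔸ˣ) : 𝔸)‖ ≤ 1)
        (Cl : ↥(cubes i.D.toDomains) → Module.End ℝ (BlkY i → 𝔸))
        {aL aD αc asep κG κD B₀ θ₁ θ₂ θ₃ : ℝ}
        (hκG : 0 ≤ κG) (hκD : 0 ≤ κD) (hB₀ : 0 ≤ B₀) (hasep : 0 ≤ asep) (hαc : 0 < αc * δ₀)
        (hsplit₁ : αst + asep + ρ ≤ aL) (hsplit₂ : αst + ρ ≤ aD) (hsplit₃ : αst + αc + ρ ≤ aL)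
        (hθ₁ : θ₁ = (3 * 5 ^ (d + 1)) * (((M₂ * ∑ j, ‖b j‖) ^ 2 * κG) * B₀ * ((ℓ : ℝ) + 1) ^ 4 * B6.c1 d' δ₀ (bb - ρ) *
          Real.exp (-(asep * δ₀ * DsepT i))))
        (hθ₂ : θ₂ = (3 * 5 ^ (d + 1)) * (κD * Real.exp (-(2 * δ₀ * DsepT i)) * B₀ * ((ℓ : ℝ) + 1) ^ 4 * B6.c1 d' δ₀ (bb - ρ)))
        (hθ₃ : θ₃ = (3 * 5 ^ (d + 1)) * ((lipT i * (αc * δ₀)⁻¹) * ((M₂ * ∑ j, ‖b j‖) ^ 2 * κG) * B₀ * ((ℓ : ℝ) + 1) ^ 4 * B6.c1 d' δ₀ (bb - ρ)))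
        (hsmall : (θ₁ + θ₂ + θ₃) * B6.c1 d' (ρ * δ₀) α' < 1)
        (hloc : ∀ c, (cutMulY (𝔸 := 𝔸) (hB i.D c)).restrictScalars ℝ *
          ((cutMulY (𝔸 := 𝔸) (chiBigT i c)).restrictScalars ℝ * (XY i parS (Oc c) U).restrictScalars ℝ) * Cl c *
            (cutMulY (𝔸 := 𝔸) (hB i.D c)).restrictScalars ℝ =
          (cutMulY (𝔸 := 𝔸) (hB i.D c)).restrictScalars ℝ * (cutMulY (𝔸 := 𝔸) (hB i.D c)).restrictScalars ℝ)
        (hC : ∀ c, HasMajorant (g := toB6 (geo9K i) (Rr i) (Hp i)) (fun p : BlkY i × ι => ιB p.1) (conj b ((etaS i ^ 2 * etaS i ^ 2)⁻¹ • Cl c))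
          (fun a a' => B₀ * ((geo9K i).len a ^ 4)⁻¹ * Real.exp (-(bb * δ₀ * (geo9K i).dist a a'))))
        (hGG : HasMajorant (g := toB6 (geo9K i) (Rr i) (Hp i)) (fun p : SiteY i × ι => ιB (blkOf i.D.toDomains p.1))
          (conj b ((etaS i ^ 2 * etaS i ^ 2) • ((Gp U).restrictScalars ℝ * (Gp U).restrictScalars ℝ)))
          (fun a a'' => κG * (geo9K i).len a ^ 4 * Real.exp (-(aL * δ₀ * (geo9K i).dist a a''))))
        (hGGc : ∀ c, HasMajorant (g := toB6 (geo9K i) (Rr i) (Hp i)) (fun p : SiteY i × ι => ιB (blkOf i.D.toDomains p.1))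
          (conj b ((etaS i ^ 2 * etaS i ^ 2) • ((Oc c U).restrictScalars ℝ * (Oc c U).restrictScalars ℝ)))
          (fun a a'' => κG * (geo9K i).len a ^ 4 * Real.exp (-(aL * δ₀ * (geo9K i).dist a a''))))
        (hD : ∀ c, HasMajorant (g := toB6 (geo9K i) (Rr i) (Hp i)) (fun p : BlkY i × ι => ιB p.1)
          (conj b ((etaS i ^ 2 * etaS i ^ 2) • ((cutMulY (𝔸 := 𝔸) (chiBigT i c)).restrictScalars ℝ *
            ((XY i parS Gp U).restrictScalars ℝ - (XY i parS (Oc c) U).restrictScalars ℝ) *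
            (cutMulY (𝔸 := 𝔸) (cubeIndT i.D (one_le_Mh i) (four_le_P' i) c)).restrictScalars ℝ)))
          (fun a a'' => κD * Real.exp (-(2 * δ₀ * DsepT i)) * (geo9K i).len a ^ 4 * Real.exp (-(aD * δ₀ * (geo9K i).dist a a'')))),
        HasMajorant (g := toB6 (geo9K i) (Rr i) (Hp i)) (fun p : BlkY i × ι => ιB p.1)
          (conj b ((etaS i ^ 2 * etaS i ^ 2)⁻¹ • (XinvY i parS Gp U).restrictScalars ℝ))
          (fun a a' => (3 * 5 ^ (d + 1)) * B₀ * B6.c1 d' (ρ * δ₀) α' * (1 - (θ₁ + θ₂ + θ₃) * B6.c1 d' (ρ * δ₀) α')⁻¹ * ((geo9K i).len a ^ 4)⁻¹ *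
            Real.exp (-((1 - α') * (ρ * δ₀) * (geo9K i).dist a a'))) := by
  -- [4] Lemma 2.1 at the two rate pairs (FILE 11 with its first pair := the second), both at the common exponent
  have h₂ : 0 < (bb - ρ) * δ₀ := mul_pos (sub_pos.mpr hρb) hδ₀
  have h₃ : 0 < α' * (ρ * δ₀) := mul_pos hα'0 (mul_pos hρ hδ₀)
  obtain ⟨ML₀, hgeo⟩ := geo_inputs3_geo9K Rr Hp h₂ h₂ h₃ (mul_pos hρ hδ₀).le hα'1
  have hst : 0 < αst * δ₀ := mul_pos hαst hδ₀
  refine ⟨max ML₀ (4 * Real.log ((ℓ : ℝ) + 1) / (αst * δ₀)),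
    max (exp261 (geo9K (d := d) (ℓ := ℓ) (hd := hd) (hL := hL) (b₀ := b₀) (b₁ := b₁)) δ₀ (bb - ρ))
      (exp261 (geo9K (d := d) (ℓ := ℓ) (hd := hd) (hL := hL) (b₀ := b₀) (b₁ := b₁)) (ρ * δ₀) α'), fun i hM => ?_⟩
  intro parS Gp U ιB Oc hι hunit hpar Cl aL aD αc asep κG κD B₀ θ₁ θ₂ θ₃ hκG hκD hB₀ hasep hαc hsplit₁ hsplit₂ hsplit₃ hθ₁ hθ₂ hθ₃ hsmall hloc hC hGG hGGc hD
  obtain ⟨-, -, -, -, -, h261b, h261, h263⟩ := hgeo i ((le_max_left _ _).trans hM)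
  -- the p. 398 scale transfer of `ℓ⁻⁴` from the explicit size condition folded into the threshold
  have hlog : 0 ≤ Real.log ((ℓ : ℝ) + 1) := Real.log_nonneg (by linarith [(Nat.cast_nonneg ℓ : (0 : ℝ) ≤ ℓ)])
  have hMst : 4 * Real.log ((ℓ : ℝ) + 1) ≤ αst * δ₀ * (2 * ((ℓ : ℝ) + 1) ^ 2 - 1) * (geo9K i).M :=
    size_of_threshold hst (by positivity) ((le_max_right _ _).trans hM)
  have hST := scaleTransfer_len_inv4_geo9K i hst hMst
  exact final_cover i b parS Gp U ιB (Rr := Rr i) (Hp := Hp i) Oc hι hunit hpar hM₂ hrepr _ Cl hκG hκD hB₀ (by positivity) hδ₀.le hasep hρ.le hρb.le hαc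
    hα'1 hsplit₁ hsplit₂ hsplit₃ hθ₁ hθ₂ hθ₃ hST h261b h261 h263 hsmall hloc hC hGG hGGc hD

/-! ## §3 ★★★ «For M sufficiently large» in full: the located smallness discharged (FILE 13's arithmetic) -/

/-- ★★★ **THEOREM 3.9 ⇒ THEOREM 3.2 (3.48) FOR `C(U) = (Q′G′²Q′*)⁻¹(U)` AT GENERIC LETTERS, AT THE CUBE COVER OF RECORD, FOR EVERY MEMBER ABOVE ONE THRESHOLD, WITH A
MEMBER-INDEPENDENT CONSTANT AND NO LOCATED SMALLNESS** («For M sufficiently large … the operator R is small … This theorem implies Theorem 3.2»): for the rate data of §2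
and constants `κ_G, B₀, κ_D ≧ 0`, `a_sep > 0`, `α_cδ₀ > 0` and the splits, there are `M_L` and `K ≧ 0` (`K = 2·3·5^{d+1}·B₀·c₁(d′, ρδ₀, α′)` at the door exponent) such that
for every member `i` with `M_L ≦ M_i` and every letter datum `(parS, G′, U)`, section `ιB`, cube letters `G′_□ = Oc □`, `C_□ = Cl □`: from `IsUnit (XY i parS G′ U)`,
contractive transporters, the site majorants `conj b ((η²η²)•(G′·G′)) ≺ κ_G·ℓ(a)⁴·e^{−a_Lδ₀d}` (and for each `G′_□`), the per-cube local inverse property, un-localized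
(3.48) blocks of the `C_□` and localized [2]-difference majorants at the cover of record,
`conj b ((η²η²)⁻¹•(XinvY i parS G′ U)) ≺ K·ℓ(a)⁻⁴·e^{−(1−α′)ρδ₀d(a,a′)}` on the block carrier `(t, j) ↦ ιB t`.
[cite: Balaban1985BackgroundPropagators, Thm 3.9 p.413 + (3.95)–(3.97) pp.411–412 + Thm 3.2 (3.48) p.398; Balaban1984PropagatorsII, (2.85)–(2.87) p.238 + Lemma 2.1 (2.66) p.234] -/
theorem final_cover_large [∀ i' : KIdx d ℓ hd hL b₀ b₁, Fintype (geo9K i').Site] [∀ i' : KIdx d ℓ hd hL b₀ b₁, DecidableEq (geo9K i').Site]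
    (Rr : KIdx d ℓ hd hL b₀ b₁ → ℝ) (Hp : KIdx d ℓ hd hL b₀ b₁ → Prop) (b : Module.Basis ι ℝ 𝔸)
    {M₂ : ℝ} (hM₂ : 0 ≤ M₂) (hrepr : ∀ (v : 𝔸) (j : ι), |b.repr v j| ≤ M₂ * ‖v‖)
    {δ₀ αst bb ρ α' aL aD αc asep κG B₀ κD : ℝ}
    (hδ₀ : 0 < δ₀) (hρ : 0 < ρ) (hρb : ρ < bb) (hα'0 : 0 < α') (hα'1 : α' ≤ 1) (hαst : 0 < αst)
    (hasep : 0 < asep) (hαc : 0 < αc * δ₀)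
    (hsplit₁ : αst + asep + ρ ≤ aL) (hsplit₂ : αst + ρ ≤ aD) (hsplit₃ : αst + αc + ρ ≤ aL) (hκG : 0 ≤ κG) (hB₀ : 0 ≤ B₀) (hκD : 0 ≤ κD) :
    ∃ ML K : ℝ, 0 ≤ K ∧ ∀ i : KIdx d ℓ hd hL b₀ b₁, ML ≤ (geo9K i).M →
      ∀ (parS : SiteParY 𝔸 i) (Gp : SiteOpY 𝔸 i) (U : CfgY 𝔸 i) (ιB : BlkY i → IBondY i) (Oc : ↥(cubes i.D.toDomains) → SiteOpY 𝔸 i)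
        (hι : ∀ s, β i.hN i.D i.hk (ιB s) = s) (hunit : IsUnit (XY i parS Gp U))
        (hpar : ∀ z w : SiteY i, ‖(parS U z w : 𝔸)‖ ≤ 1 ∧ ‖(((parS U z w)⁻¹ : 𝔸ˣ) : 𝔸)‖ ≤ 1)
        (Cl : ↥(cubes i.D.toDomains) → Module.End ℝ (BlkY i → 𝔸))
        (hloc : ∀ c, (cutMulY (𝔸 := 𝔸) (hB i.D c)).restrictScalars ℝ *
          ((cutMulY (𝔸 := 𝔸) (chiBigT i c)).restrictScalars ℝ * (XY i parS (Oc c) U).restrictScalars ℝ) * Cl c *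
            (cutMulY (𝔸 := 𝔸) (hB i.D c)).restrictScalars ℝ =
          (cutMulY (𝔸 := 𝔸) (hB i.D c)).restrictScalars ℝ * (cutMulY (𝔸 := 𝔸) (hB i.D c)).restrictScalars ℝ)
        (hC : ∀ c, HasMajorant (g := toB6 (geo9K i) (Rr i) (Hp i)) (fun p : BlkY i × ι => ιB p.1) (conj b ((etaS i ^ 2 * etaS i ^ 2)⁻¹ • Cl c))
          (fun a a' => B₀ * ((geo9K i).len a ^ 4)⁻¹ * Real.exp (-(bb * δ₀ * (geo9K i).dist a a'))))
        (hGG : HasMajorant (g := toB6 (geo9K i) (Rr i) (Hp i)) (fun p : SiteY i × ι => ιB (blkOf i.D.toDomains p.1))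
          (conj b ((etaS i ^ 2 * etaS i ^ 2) • ((Gp U).restrictScalars ℝ * (Gp U).restrictScalars ℝ)))
          (fun a a'' => κG * (geo9K i).len a ^ 4 * Real.exp (-(aL * δ₀ * (geo9K i).dist a a''))))
        (hGGc : ∀ c, HasMajorant (g := toB6 (geo9K i) (Rr i) (Hp i)) (fun p : SiteY i × ι => ιB (blkOf i.D.toDomains p.1))
          (conj b ((etaS i ^ 2 * etaS i ^ 2) • ((Oc c U).restrictScalars ℝ * (Oc c U).restrictScalars ℝ)))
          (fun a a'' => κG * (geo9K i).len a ^ 4 * Real.exp (-(aL * δ₀ * (geo9K i).dist a a''))))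
        (hD : ∀ c, HasMajorant (g := toB6 (geo9K i) (Rr i) (Hp i)) (fun p : BlkY i × ι => ιB p.1)
          (conj b ((etaS i ^ 2 * etaS i ^ 2) • ((cutMulY (𝔸 := 𝔸) (chiBigT i c)).restrictScalars ℝ *
            ((XY i parS Gp U).restrictScalars ℝ - (XY i parS (Oc c) U).restrictScalars ℝ) *
            (cutMulY (𝔸 := 𝔸) (cubeIndT i.D (one_le_Mh i) (four_le_P' i) c)).restrictScalars ℝ)))
          (fun a a'' => κD * Real.exp (-(2 * δ₀ * DsepT i)) * (geo9K i).len a ^ 4 * Real.exp (-(aD * δ₀ * (geo9K i).dist a a'')))),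
        HasMajorant (g := toB6 (geo9K i) (Rr i) (Hp i)) (fun p : BlkY i × ι => ιB p.1)
          (conj b ((etaS i ^ 2 * etaS i ^ 2)⁻¹ • (XinvY i parS Gp U).restrictScalars ℝ))
          (fun a a' => K * ((geo9K i).len a ^ 4)⁻¹ * Real.exp (-((1 - α') * (ρ * δ₀) * (geo9K i).dist a a'))) := by
  obtain ⟨ML, d', h12⟩ := final_cover_above (𝔸 := 𝔸) Rr Hp b hM₂ hrepr hδ₀ hρ hρb hα'0 hα'1 hαst
  -- the constants of the three sums (door exponent fixed)
  have hc0 : 0 ≤ B6.c1 d' (ρ * δ₀) α' := B6RandomWalk.c1_nonneg _ _ _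
  have hcb0 : 0 ≤ B6.c1 d' δ₀ (bb - ρ) := B6RandomWalk.c1_nonneg _ _ _
  have hP0 : 0 ≤ (M₂ * ∑ j, ‖b j‖) ^ 2 * κG := mul_nonneg (sq_nonneg _) hκG
  have hL40 : 0 ≤ ((ℓ : ℝ) + 1) ^ 4 := pow_nonneg (by positivity) 4
  have hN0 : (0 : ℝ) ≤ 3 * 5 ^ (d + 1) := by positivity
  obtain ⟨K₁, hK₁⟩ : ∃ K₁ : ℝ, K₁ = (3 * 5 ^ (d + 1)) * (((M₂ * ∑ j, ‖b j‖) ^ 2 * κG) * B₀ * ((ℓ : ℝ) + 1) ^ 4 * B6.c1 d' δ₀ (bb - ρ)) := ⟨_, rfl⟩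
  obtain ⟨K₂, hK₂⟩ : ∃ K₂ : ℝ, K₂ = (3 * 5 ^ (d + 1)) * (κD * B₀ * ((ℓ : ℝ) + 1) ^ 4 * B6.c1 d' δ₀ (bb - ρ)) := ⟨_, rfl⟩
  obtain ⟨K₃, hK₃⟩ : ∃ K₃ : ℝ, K₃ = (3 * 5 ^ (d + 1)) * ((2 * sLipT d ℓ * (αc * δ₀)⁻¹) * ((M₂ * ∑ j, ‖b j‖) ^ 2 * κG) * B₀ * ((ℓ : ℝ) + 1) ^ 4 *
      B6.c1 d' δ₀ (bb - ρ)) := ⟨_, rfl⟩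
  have hK₁0 : 0 ≤ K₁ := by rw [hK₁]; exact mul_nonneg hN0 (mul_nonneg (mul_nonneg (mul_nonneg hP0 hB₀) hL40) hcb0)
  have hK₂0 : 0 ≤ K₂ := by rw [hK₂]; exact mul_nonneg hN0 (mul_nonneg (mul_nonneg (mul_nonneg hκD hB₀) hL40) hcb0)
  have ha₁ : 0 < asep * δ₀ / (2 * ((ℓ : ℝ) + 1) ^ 2) := by positivity
  have ha₂ : 0 < 2 * δ₀ / (2 * ((ℓ : ℝ) + 1) ^ 2) := by positivity
  have hNB : 0 ≤ (3 * 5 ^ (d + 1)) * B₀ * B6.c1 d' (ρ * δ₀) α' := mul_nonneg (mul_nonneg hN0 hB₀) hc0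
  refine ⟨max ML (max 1 (max (6 * K₁ * B6.c1 d' (ρ * δ₀) α' / (asep * δ₀ / (2 * ((ℓ : ℝ) + 1) ^ 2)))
      (max (6 * K₂ * B6.c1 d' (ρ * δ₀) α' / (2 * δ₀ / (2 * ((ℓ : ℝ) + 1) ^ 2))) (6 * K₃ * B6.c1 d' (ρ * δ₀) α')))),
    2 * ((3 * 5 ^ (d + 1)) * B₀ * B6.c1 d' (ρ * δ₀) α'), mul_nonneg zero_le_two hNB, fun i hM => ?_⟩
  intro parS Gp U ιB Oc hι hunit hpar Cl hloc hC hGG hGGc hD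
  have hML : ML ≤ (geo9K i).M := (le_max_left _ _).trans hM
  have hM1 : (1 : ℝ) ≤ (geo9K i).M := ((le_max_left _ _).trans (le_max_right _ _)).trans hM
  have hM0 : 0 < (geo9K i).M := lt_of_lt_of_le one_pos hM1
  have hT₁ : 6 * K₁ * B6.c1 d' (ρ * δ₀) α' / (asep * δ₀ / (2 * ((ℓ : ℝ) + 1) ^ 2)) ≤ (geo9K i).M :=
    (((le_max_left _ _).trans (le_max_right _ _)).trans (le_max_right _ _)).trans hM
  have hT₂ : 6 * K₂ * B6.c1 d' (ρ * δ₀) α' / (2 * δ₀ / (2 * ((ℓ : ℝ) + 1) ^ 2)) ≤ (geo9K i).M :=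
    ((((le_max_left _ _).trans (le_max_right _ _)).trans (le_max_right _ _)).trans (le_max_right _ _)).trans hM
  have hT₃ : 6 * K₃ * B6.c1 d' (ρ * δ₀) α' ≤ (geo9K i).M :=
    ((((le_max_right _ _).trans (le_max_right _ _)).trans (le_max_right _ _)).trans (le_max_right _ _)).trans hM
  have hD₁ : asep * δ₀ * DsepT i = asep * δ₀ / (2 * ((ℓ : ℝ) + 1) ^ 2) * (geo9K i).M := by rw [DsepT_eq_div]; ring
  have hD₂ : 2 * δ₀ * DsepT i = 2 * δ₀ / (2 * ((ℓ : ℝ) + 1) ^ 2) * (geo9K i).M := by rw [DsepT_eq_div]; ring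
  -- the located smallness of §2, discharged
  have hS : ((3 * 5 ^ (d + 1)) * (((M₂ * ∑ j, ‖b j‖) ^ 2 * κG) * B₀ * ((ℓ : ℝ) + 1) ^ 4 * B6.c1 d' δ₀ (bb - ρ) * Real.exp (-(asep * δ₀ * DsepT i))) +
      (3 * 5 ^ (d + 1)) * (κD * Real.exp (-(2 * δ₀ * DsepT i)) * B₀ * ((ℓ : ℝ) + 1) ^ 4 * B6.c1 d' δ₀ (bb - ρ)) +
      (3 * 5 ^ (d + 1)) * ((lipT i * (αc * δ₀)⁻¹) * ((M₂ * ∑ j, ‖b j‖) ^ 2 * κG) * B₀ * ((ℓ : ℝ) + 1) ^ 4 * B6.c1 d' δ₀ (bb - ρ))) *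
      B6.c1 d' (ρ * δ₀) α' ≤ 2⁻¹ :=
    smallness_shape hK₁0 hK₂0 hc0 ha₁ ha₂ hM0 hD₁ hD₂ (lipT_eq i) hK₁ hK₂ hK₃ hT₁ hT₂ hT₃
  have h := h12 i hML parS Gp U ιB Oc hι hunit hpar Cl hκG hκD hB₀ hasep.le hαc hsplit₁ hsplit₂ hsplit₃ rfl rfl rfl
    (lt_of_le_of_lt hS (by norm_num)) hloc hC hGG hGGc hD
  -- `(1 − (θ₁+θ₂+θ₃)c₁)⁻¹ ≦ 2`
  refine hasMajorant_mono (g := toB6 (geo9K i) (Rr i) (Hp i)) _ h fun a a' => ?_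
  set S := ((3 * 5 ^ (d + 1)) * (((M₂ * ∑ j, ‖b j‖) ^ 2 * κG) * B₀ * ((ℓ : ℝ) + 1) ^ 4 * B6.c1 d' δ₀ (bb - ρ) * Real.exp (-(asep * δ₀ * DsepT i))) +
      (3 * 5 ^ (d + 1)) * (κD * Real.exp (-(2 * δ₀ * DsepT i)) * B₀ * ((ℓ : ℝ) + 1) ^ 4 * B6.c1 d' δ₀ (bb - ρ)) +
      (3 * 5 ^ (d + 1)) * ((lipT i * (αc * δ₀)⁻¹) * ((M₂ * ∑ j, ‖b j‖) ^ 2 * κG) * B₀ * ((ℓ : ℝ) + 1) ^ 4 * B6.c1 d' δ₀ (bb - ρ))) *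
      B6.c1 d' (ρ * δ₀) α' with hSdef
  have hX : (1 - S)⁻¹ ≤ 2 := by
    have h2 : (2 : ℝ)⁻¹ ≤ 1 - S := by linarith [hS]
    calc (1 - S)⁻¹ ≤ ((2 : ℝ)⁻¹)⁻¹ := inv_anti₀ (by norm_num) h2
      _ = 2 := inv_inv 2
  have hW : 0 ≤ ((geo9K i).len a ^ 4)⁻¹ * Real.exp (-((1 - α') * (ρ * δ₀) * (geo9K i).dist a a')) :=
    mul_nonneg (inv_nonneg.mpr (pow_nonneg (B6KLevelCensusIndexV1.len_pos i a).le 4)) (Real.exp_nonneg _)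
  calc (3 * 5 ^ (d + 1)) * B₀ * B6.c1 d' (ρ * δ₀) α' * (1 - S)⁻¹ * ((geo9K i).len a ^ 4)⁻¹ *
        Real.exp (-((1 - α') * (ρ * δ₀) * (geo9K i).dist a a'))
      = ((3 * 5 ^ (d + 1)) * B₀ * B6.c1 d' (ρ * δ₀) α' * (1 - S)⁻¹) *
          (((geo9K i).len a ^ 4)⁻¹ * Real.exp (-((1 - α') * (ρ * δ₀) * (geo9K i).dist a a'))) := by ring
    _ ≤ ((3 * 5 ^ (d + 1)) * B₀ * B6.c1 d' (ρ * δ₀) α' * 2) *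
          (((geo9K i).len a ^ 4)⁻¹ * Real.exp (-((1 - α') * (ρ * δ₀) * (geo9K i).dist a a'))) :=
        mul_le_mul_of_nonneg_right (mul_le_mul_of_nonneg_left hX hNB) hW
    _ = 2 * ((3 * 5 ^ (d + 1)) * B₀ * B6.c1 d' (ρ * δ₀) α') * ((geo9K i).len a ^ 4)⁻¹ *
          Real.exp (-((1 - α') * (ρ * δ₀) * (geo9K i).dist a a')) := by ring

end Literature.MathematicalPhysics.QuantumFieldTheory.Balaban1983to89.B9Thm39CinvAtCoverMember

end
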